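import Summits.CriticalPhenomena.SAWScalingLimit.Theorems.SAWCircleScreeningScreeningRecursionMarkov
import Summits.CriticalPhenomena.SAWScalingLimit.Theorems.SAWCircleScreeningScreeningRecursionScreenLaw
import Summits.CriticalPhenomena.SAWScalingLimit.Theorems.SAWCircleScreeningScreeningRecursionLawReal
import HarnessLib

/-!
# Screening recursion for `SAWCircleScreening`, part XIV: the Markov kernel of the coupling step

Route `SAWCircleScreening` of `CriticalPhenomena/SAWScalingLimit`, support item
`ScreeningRecursion` (stmt-CriticalPhenomena-5468). The abstract coupling step (part IIb) consumes
the domain Markov property in the integrated form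

  `∑ₓ p x · g(prefix x) · 1[Φ x ∈ A] = ∑ₓ p x · g(prefix x) · μₓ(A)`,

where `prefix x` is the support of the SAW `x` up to and including its first vertex at distance
`≥ Mρ` from `c`, and `μₓ` is the law of `Φ` under the critical SAW of `(Ω₀ ∖ K')_δ` started at
that vertex, `K' = K ∪ δ·(prefix ∖ last)` (`markov_identity`). It is obtained from `law_markov`
(part VII) by summing over the finitely many prefixes: the fibre `{prefix = π}` is the cylinder
`{π ≼ support}` (`prefix_fiber_eq_cylinder`), on which `Φ` only sees the suffix (regrouping
via `sum_mul_apply_eq_sum_image`, part XIII). Also recorded: the first-exit facts for SAW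
supports. Folklore.
-/

noncomputable section

open Set Metric MeasureTheory Finset
open scoped ENNReal
open Literature.Probability.LatticeModels
open Literature.Probability.RandomPlanarGeometry
open Literature.Probability.RandomPlanarGeometry.SAW

namespace Summit.CriticalPhenomena.SAWScalingLimit.Theorems.ScreeningRecursion

variable {δ : ℝ} {c : ℂ}

/-! ## First-exit prefixes of SAW supports -/

section Prefix

variable {Ω₀ K : Set ℂ} {a b : Site 2} {R : ℝ}

/-- For a SAW from `a` (inside `B(c, R)`) to `b` (outside): the first exit index `τ` of `B(c, R)`
satisfies `0 < τ < |support|`, `support[τ]` is outside, earlier vertices inside, and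
`dist(support[τ], c) < R + δ`. [folklore] -/
theorem exit_spec (hδ : 0 < δ) (ha : dist (meshPoint δ a) c < R) (hbR : R ≤ dist (meshPoint δ b) c)
    (x : DomainSAW (Ω₀ \ K) δ a b) :
    0 < x.walk.support.findIdx (fun w => decide (R ≤ dist (meshPoint δ w) c)) ∧
    (∃ hτ : x.walk.support.findIdx (fun w => decide (R ≤ dist (meshPoint δ w) c)) < x.walk.support.length,
      R ≤ dist (meshPoint δ (x.walk.support[x.walk.support.findIdx
        (fun w => decide (R ≤ dist (meshPoint δ w) c))])) c ∧
      dist (meshPoint δ (x.walk.support[x.walk.support.findIdx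
        (fun w => decide (R ≤ dist (meshPoint δ w) c))])) c < R + δ) ∧
    ∀ w ∈ x.walk.support.take (x.walk.support.findIdx (fun w => decide (R ≤ dist (meshPoint δ w) c))),
      dist (meshPoint δ w) c < R := by
  set P : Site 2 → Bool := fun w => decide (R ≤ dist (meshPoint δ w) c) with hP
  have hne : x.walk.support ≠ [] := SimpleGraph.Walk.support_ne_nil _
  obtain ⟨h0, ⟨hτ, hout⟩, hin⟩ := firstExit_spec (r := R) x.walk.support hne
    (by rw [SimpleGraph.Walk.head_support]; exact ha) (by rw [SimpleGraph.Walk.getLast_support]; exact hbR)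
  refine ⟨h0, ⟨hτ, hout, ?_⟩, hin⟩
  -- the previous vertex is inside and adjacent
  generalize hτeq : x.walk.support.findIdx P = τ at h0 hτ hout hin ⊢
  obtain ⟨m, hm⟩ : ∃ m, τ = m + 1 := ⟨τ - 1, by omega⟩
  subst hm
  have hmlt : m < x.walk.support.length := by omega
  have hin' : dist (meshPoint δ (x.walk.support[m])) c < R := by
    refine hin _ ?_
    have h := List.getElem_mem (l := x.walk.support.take (m + 1)) (n := m)
      (by rw [List.length_take]; omega)
    rwa [List.getElem_take] at h
  have hadj : (zdGraph 2).Adj (x.walk.getVert m) (x.walk.getVert (m + 1)) := by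
    have h := x.walk.adj_getVert_succ (i := m) (by rw [SimpleGraph.Walk.length_support] at hτ; omega)
    exact (meshGraph_adj_iff.1 (discreteDomainGraph_adj_iff.1 h).1).1
  rw [getVert_eq_getElem_support _ hmlt, getVert_eq_getElem_support _ (by omega)] at hadj
  have hd := dist_meshPoint_le_of_adj hδ.le hadj
  rw [dist_comm] at hd
  have := dist_triangle (meshPoint δ (x.walk.support[m + 1])) (meshPoint δ (x.walk.support[m])) c
  linarith

/-- **The prefix fibre is a cylinder.** If `π` is the first-exit prefix of some SAW `x₀`, then
for every SAW `x`: its first-exit prefix is `π` iff `π` is a prefix of its support. [folklore] -/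
theorem prefix_fiber_eq_cylinder (hδ : 0 < δ) (ha : dist (meshPoint δ a) c < R)
    (hbR : R ≤ dist (meshPoint δ b) c) (x₀ x : DomainSAW (Ω₀ \ K) δ a b) :
    x.walk.support.take (x.walk.support.findIdx (fun w => decide (R ≤ dist (meshPoint δ w) c)) + 1) =
        x₀.walk.support.take (x₀.walk.support.findIdx (fun w => decide (R ≤ dist (meshPoint δ w) c)) + 1) ↔
      x₀.walk.support.take (x₀.walk.support.findIdx (fun w => decide (R ≤ dist (meshPoint δ w) c)) + 1) <+:
        x.walk.support := by
  set P : Site 2 → Bool := fun w => decide (R ≤ dist (meshPoint δ w) c) with hP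
  obtain ⟨-, ⟨hτ₀, hout₀, -⟩, hin₀⟩ := exit_spec hδ ha hbR x₀
  set τ₀ := x₀.walk.support.findIdx P with hτ₀_def
  set π := x₀.walk.support.take (τ₀ + 1) with hπ
  have hπeq : π = x₀.walk.support.take τ₀ ++ [x₀.walk.support[τ₀]] := by
    rw [hπ, ← List.take_append_getElem hτ₀]
  constructor
  · intro h
    rw [← h]
    exact List.take_prefix _ _
  · rintro ⟨rest, hrest⟩
    have hdec : x.walk.support = x₀.walk.support.take τ₀ ++ (x₀.walk.support[τ₀] :: rest) := by
      rw [← hrest, hπeq, List.append_assoc]; rfl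
    have hidx : x.walk.support.findIdx P = τ₀ := by
      rw [hdec, findIdx_of_decomp (r := R) _ _ hin₀ (List.cons_ne_nil _ _) (by simpa using hout₀),
        List.length_take]
      omega
    show x.walk.support.take (x.walk.support.findIdx P + 1) = π
    rw [hidx, hdec, hπeq, show τ₀ + 1 = (x₀.walk.support.take τ₀).length + 1 by
      rw [List.length_take]; omega, List.take_length_add_append]
    simp

end Prefix

/-! ## The Markov kernel identity -/

/-- **The Markov identity of the coupling step.** Bounded `Ω₀`, near data `K ⊆ B̄(c, ρ)`, start
`a` within `ρ < Mρ` of `c`, target `b` at distance `≥ Mρ + δ` with `b ∈ (Ω₀ ∖ K)_δ` and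
`b ∈ (Ω₀ ∖ K')_δ` for every `K' ⊆ B̄(c, Mρ)` (the largest-component proviso); `Φ` an observable
forgetting initial segments inside `B(c, R⋆)`, `R⋆ ≥ Mρ + δ`. Then for every weight `g` of the
first-exit prefix and every `A`:
`∑ₓ p x g(prefix x) 1[Φ x ∈ A] = ∑ₓ p x g(prefix x) μₓ(A)`, where `μₓ(A)` is the law of `Φ`
under the critical SAW of `(Ω₀ ∖ (K ∪ δ·(prefix x ∖ last)))_δ` from the exit vertex to `b`.
[folklore] -/
theorem markov_identity {Ω₀ K : Set ℂ} {ρ M Rstar : ℝ} {a b : Site 2}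
    (hΩ₀ : Bornology.IsBounded Ω₀) (hδ : 0 < δ) (hK : K ⊆ closedBall c ρ)
    (ha : dist (meshPoint δ a) c ≤ ρ) (hρM : ρ < M * ρ) (hbfar : M * ρ + δ ≤ dist (meshPoint δ b) c)
    (hb : b ∈ meshDomain (Ω₀ \ K) δ)
    (hgeomK' : ∀ K' : Set ℂ, K' ⊆ closedBall c (M * ρ) → b ∈ meshDomain (Ω₀ \ K') δ)
    {Z : Type*} (Φ : List (Site 2) → Z) (hRstar : M * ρ + δ ≤ Rstar)
    (hΦ : ∀ pfx l : List (Site 2), (∀ w ∈ pfx, dist (meshPoint δ w) c < Rstar) →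
      (∃ h : l ≠ [], dist (meshPoint δ (l.head h)) c < Rstar) → Φ (pfx ++ l) = Φ l)
    [Fintype (DomainSAW (Ω₀ \ K) δ a b)] (g : List (Site 2) → ℝ) (A : Set Z)
    [DecidablePred (· ∈ A)] :
    ∑ x : DomainSAW (Ω₀ \ K) δ a b, (law (Ω₀ \ K) δ a b {x}).toReal *
        g (x.walk.support.take (x.walk.support.findIdx
          (fun w => decide (M * ρ ≤ dist (meshPoint δ w) c)) + 1)) *
        (if Φ x.walk.support ∈ A then 1 else 0) =
      ∑ x : DomainSAW (Ω₀ \ K) δ a b, (law (Ω₀ \ K) δ a b {x}).toReal *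
        g (x.walk.support.take (x.walk.support.findIdx
          (fun w => decide (M * ρ ≤ dist (meshPoint δ w) c)) + 1)) *
        (law (Ω₀ \ (K ∪ meshPoint δ '' {w | w ∈ x.walk.support.take (x.walk.support.findIdx
            (fun w => decide (M * ρ ≤ dist (meshPoint δ w) c)))}))
          δ (x.walk.getVert (x.walk.support.findIdx (fun w => decide (M * ρ ≤ dist (meshPoint δ w) c)))) b
          {β | Φ β.walk.support ∈ A}).toReal := by
  classical
  have haM : dist (meshPoint δ a) c < M * ρ := lt_of_le_of_lt ha hρM
  have hbM : M * ρ ≤ dist (meshPoint δ b) c := by linarith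
  set p : DomainSAW (Ω₀ \ K) δ a b → ℝ := fun x => (law (Ω₀ \ K) δ a b {x}).toReal with hp
  set pf : DomainSAW (Ω₀ \ K) δ a b → List (Site 2) :=
    fun x => x.walk.support.take (x.walk.support.findIdx
      (fun w => decide (M * ρ ≤ dist (meshPoint δ w) c)) + 1) with hpf
  set mu : DomainSAW (Ω₀ \ K) δ a b → ℝ := fun x =>
    (law (Ω₀ \ (K ∪ meshPoint δ '' {w | w ∈ x.walk.support.take (x.walk.support.findIdx
        (fun w => decide (M * ρ ≤ dist (meshPoint δ w) c)))}))
      δ (x.walk.getVert (x.walk.support.findIdx (fun w => decide (M * ρ ≤ dist (meshPoint δ w) c)))) b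
      {β | Φ β.walk.support ∈ A}).toReal with hmu
  change ∑ x, p x * g (pf x) * (if Φ x.walk.support ∈ A then 1 else 0) = ∑ x, p x * g (pf x) * mu x
  -- regroup both sides along the prefix
  have e1 : ∑ x, p x * g (pf x) * (if Φ x.walk.support ∈ A then (1:ℝ) else 0) =
      ∑ π ∈ univ.image pf, g π * ∑ x ∈ univ.filter (fun x => pf x = π),
        p x * (if Φ x.walk.support ∈ A then (1:ℝ) else 0) := by
    rw [← sum_mul_apply_eq_sum_image]
    exact Finset.sum_congr rfl fun x _ => by ring
  have e2 : ∑ x, p x * g (pf x) * mu x =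
      ∑ π ∈ univ.image pf, g π * ∑ x ∈ univ.filter (fun x => pf x = π), p x * mu x := by
    rw [← sum_mul_apply_eq_sum_image]
    exact Finset.sum_congr rfl fun x _ => by ring
  rw [e1, e2]
  refine Finset.sum_congr rfl fun π hπ => ?_
  congr 1
  obtain ⟨x₀, -, hx₀⟩ := Finset.mem_image.1 hπ
  -- facts about `x₀`'s prefix `π`
  obtain ⟨hpos, ⟨hτ₀, hout₀, hlt₀⟩, hin₀⟩ := exit_spec (R := M * ρ) hδ haM hbM x₀
  generalize hτ₀eq : (x₀.walk.support.findIdx fun w => decide (M * ρ ≤ dist (meshPoint δ w) c)) = τ₀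
    at hpos hτ₀ hout₀ hlt₀ hin₀
  set v : Site 2 := x₀.walk.support[τ₀] with hvs
  have hπeq : π = x₀.walk.support.take τ₀ ++ [v] := by
    rw [← hx₀]
    show x₀.walk.support.take (x₀.walk.support.findIdx
      (fun w => decide (M * ρ ≤ dist (meshPoint δ w) c)) + 1) = _
    rw [hτ₀eq]
    exact (List.take_append_getElem hτ₀).symm
  have htakelen : (x₀.walk.support.take τ₀).length = τ₀ := by rw [List.length_take]; omega
  have hπlen : π.length = τ₀ + 1 := by rw [hπeq, List.length_append, htakelen, List.length_singleton]
  have hπdrop : π.dropLast = x₀.walk.support.take τ₀ := by rw [hπeq]; simp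
  -- for `x` in the fibre, the kernel is the kernel of `π`
  set K' : Set ℂ := K ∪ meshPoint δ '' {w | w ∈ x₀.walk.support.take τ₀} with hK'
  set Mπ : ℝ := (law (Ω₀ \ K') δ v b {β | Φ β.walk.support ∈ A}).toReal with hMπ
  have hfib : ∀ x : DomainSAW (Ω₀ \ K) δ a b, pf x = π → mu x = Mπ := by
    intro x hx
    have hpre : π <+: x.walk.support := by rw [← hx]; exact List.take_prefix _ _
    obtain ⟨rest, hrest⟩ := hpre
    have hdec : x.walk.support = x₀.walk.support.take τ₀ ++ (v :: rest) := by
      rw [← hrest, hπeq, List.append_assoc]; rfl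
    have hidx : (x.walk.support.findIdx fun w => decide (M * ρ ≤ dist (meshPoint δ w) c)) = τ₀ := by
      rw [hdec, findIdx_of_decomp (r := M * ρ) _ _ hin₀ (List.cons_ne_nil _ _)
        (by rw [List.head_cons]; exact hout₀), htakelen]
    have htake : x.walk.support.take τ₀ = x₀.walk.support.take τ₀ := by
      rw [hdec, List.take_left' htakelen]
    have hlenx : τ₀ < x.walk.support.length := by
      rw [hdec, List.length_append, htakelen, List.length_cons]; omega
    have hgv : x.walk.getVert τ₀ = v := by
      rw [getVert_eq_getElem_support _ hlenx]
      simp only [hdec]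
      rw [List.getElem_append_right (by rw [htakelen])]
      simp [htakelen]
    show (law (Ω₀ \ (K ∪ meshPoint δ '' {w | w ∈ x.walk.support.take (x.walk.support.findIdx
        (fun w => decide (M * ρ ≤ dist (meshPoint δ w) c)))}))
      δ (x.walk.getVert (x.walk.support.findIdx (fun w => decide (M * ρ ≤ dist (meshPoint δ w) c)))) b
      {β | Φ β.walk.support ∈ A}).toReal = Mπ
    rw [hidx, htake, hgv]
  have e3 : ∑ x ∈ univ.filter (fun x => pf x = π), p x * mu x =
      Mπ * ∑ x ∈ univ.filter (fun x => pf x = π), p x := by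
    rw [Finset.mul_sum]
    refine Finset.sum_congr rfl fun x hx => ?_
    rw [hfib x (Finset.mem_filter.1 hx).2]; ring
  rw [e3]
  -- both fibre sums are laws of events
  have e4 : ∑ x ∈ univ.filter (fun x => pf x = π), p x * (if Φ x.walk.support ∈ A then (1:ℝ) else 0) =
      (law (Ω₀ \ K) δ a b ({x | pf x = π} ∩ {x | Φ x.walk.support ∈ A})).toReal := by
    rw [toReal_law_inter_eq_sum_filter pf π {x | Φ x.walk.support ∈ A}]
    exact Finset.sum_congr rfl fun x _ => by simp [hp]
  have e5 : ∑ x ∈ univ.filter (fun x => pf x = π), p x = (law (Ω₀ \ K) δ a b {x | pf x = π}).toReal := by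
    have := toReal_law_inter_eq_sum_filter pf π (univ : Set (DomainSAW (Ω₀ \ K) δ a b))
    rw [Set.inter_univ] at this
    rw [this]
    exact Finset.sum_congr rfl fun x _ => by simp [hp]
  rw [e4, e5]
  -- the fibre is the cylinder `{π ≼ support}`
  have hcyl : {x : DomainSAW (Ω₀ \ K) δ a b | pf x = π} = {x | π <+: x.walk.support} := by
    ext x
    simp only [mem_setOf_eq, hpf, ← hx₀]
    exact prefix_fiber_eq_cylinder hδ haM hbM x₀ x
  -- on the cylinder `Φ` sees only the suffix
  have hΦcyl : ∀ x : DomainSAW (Ω₀ \ K) δ a b, π <+: x.walk.support →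
      (Φ x.walk.support ∈ A ↔ x.walk.support.drop (π.length - 1) ∈ {l | Φ l ∈ A}) := by
    rintro x ⟨rest, hrest⟩
    have hdec : x.walk.support = x₀.walk.support.take τ₀ ++ (v :: rest) := by
      rw [← hrest, hπeq, List.append_assoc]; rfl
    rw [mem_setOf_eq, hdec, hπlen, Nat.add_sub_cancel, List.drop_left' htakelen,
      hΦ _ (v :: rest) (fun w hw => by have := hin₀ w hw; linarith) ⟨List.cons_ne_nil _ _, by
        rw [List.head_cons]; linarith⟩]
  have hev : {x : DomainSAW (Ω₀ \ K) δ a b | pf x = π} ∩ {x | Φ x.walk.support ∈ A} =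
      {x | π <+: x.walk.support ∧ x.walk.support.drop (π.length - 1) ∈ {l | Φ l ∈ A}} := by
    rw [hcyl]; ext x
    simp only [mem_inter_iff, mem_setOf_eq]
    constructor
    · rintro ⟨h1, h2⟩; exact ⟨h1, (hΦcyl x h1).1 h2⟩
    · rintro ⟨h1, h2⟩; exact ⟨h1, (hΦcyl x h1).2 h2⟩
  rw [hev, hcyl]
  -- the prefix as a self-avoiding walk `α` from `a` to `v`, and the Markov property
  have hv0 : x₀.walk.getVert τ₀ = v := getVert_eq_getElem_support _ hτ₀
  set α : (discreteDomainGraph (Ω₀ \ K) δ).Walk a v := (x₀.walk.take τ₀).copy rfl hv0 with hα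
  have hαsupp : α.support = π := by
    rw [hα, SimpleGraph.Walk.support_copy, SimpleGraph.Walk.support_take, ← hx₀]
    show _ = x₀.walk.support.take (x₀.walk.support.findIdx
      (fun w => decide (M * ρ ≤ dist (meshPoint δ w) c)) + 1)
    rw [hτ₀eq]
  have hαlen : α.length = π.length - 1 := by
    have := SimpleGraph.Walk.length_support α; rw [hαsupp] at this; omega
  have hαpath : α.IsPath := by
    rw [SimpleGraph.Walk.isPath_def, hα, SimpleGraph.Walk.support_copy, SimpleGraph.Walk.support_take]
    exact x₀.isPath.support_nodup.sublist (List.take_sublist _ _)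
  have hK'eq : K' = K ∪ meshPoint δ '' {w | w ∈ α.support.dropLast} := by rw [hαsupp, hπdrop]
  have hK'ball : K' ⊆ closedBall c (M * ρ) := by
    rintro z (hz | ⟨w, hw, rfl⟩)
    · exact closedBall_subset_closedBall hρM.le (hK hz)
    · exact mem_closedBall.2 (hin₀ w hw).le
  have key := law_markov hΩ₀ hδ α hαpath hK'eq hb (hgeomK' K' hK'ball) {l | Φ l ∈ A}
  rw [hαsupp, hαlen] at key
  rw [key, ENNReal.toReal_mul, mul_comm]
  rfl

end Summit.CriticalPhenomena.SAWScalingLimit.Theorems.ScreeningRecursion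

end
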